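import Literature.Geometry.Riemannian.ConjugateHeatKernelPositivity
import Literature.Geometry.Riemannian.HeatPropagationSpaceTime
import HarnessLib

/-!
# Continuity of the conjugate heat kernel in the base point and base time
# (Bamler 2020a, §2.3: `K(x,t;y,s)` is continuous in all variables)

R. Bamler, *Entropy and heat kernel bounds on a Ricci flow background*, arXiv:2008.07093 (2020a),
§2.3 treats the heat kernel `K(x,t;y,s)` as a smooth function of all four arguments. The tree
has, for each base time `t`, a family `K x = K(x,t;·,·)` of smooth positive densities of the heat
kernel measures, jointly continuous in `(x, y, s)` (`IsRicciFlow.exists_conjugateHeatKernel_family_pos`,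
`ConjugateHeatKernelPositivity.lean`). This file organises the kernels of ALL base times
`t ∈ (a, T]` of a Ricci flow on `[a, T]` into one function `𝒦 t x (y, s)` and proves continuity in
the base variables `(x, t)`:

* `continuousOn_heatValueC_spaceTime`, `continuousOn_integral_heatKernelMeasure_spaceTime` —
  `(x, t) ↦ ∫ g dν_{x,t;r}` is continuous on `M × (r, ∞)` for continuous `g` (uniform limit of the
  smooth space-time heat propagations of smooth approximants of `g`).
* `continuousOn_integral_heatKernelMeasure_param` — the same with a continuous parameter in the
  integrand.
* `IsRicciFlow.exists_conjugateHeatKernel_timeFamily` — the kernels of all base times at once.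
* `continuousOn_conjugateHeatKernel_timeFamily` — `((x, t), y) ↦ 𝒦 t x (y, s)` is continuous on
  `(M × (s, T]) × M` (reproduction `𝒦 t x (y, s) = ∫ 𝒦 r z (y, s) dν_{x,t;r}(z)` through an
  intermediate time `r`, `conjugateHeatKernel_family_reproduction`).

Everything is proved; no definitions, no named facts.

## References

* R. H. Bamler, *Entropy and heat kernel bounds on a Ricci flow background*, arXiv:2008.07093
  (2020), §2.3. [Bamler2020Entropy]
-/

noncomputable section

open Bundle Set Function Filter Manifold MeasureTheory Measure TopologicalSpace
open scoped Manifold ContDiff Topology ENNReal NNReal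

namespace Literature.Geometry.Riemannian

open Lorentzian Lorentzian.PseudoRiemannianMetric

section BasePoint

variable {m : ℕ} {H : Type*} [TopologicalSpace H]
  {I : ModelWithCorners ℝ (EuclideanSpace ℝ (Fin m)) H} [I.Boundaryless]
  {M : Type*} [TopologicalSpace M] [ChartedSpace H M] [IsManifold I ∞ M]
  [T2Space M] [CompactSpace M] [SecondCountableTopology M] [MeasurableSpace M] [BorelSpace M]
  {h : ℝ → PseudoRiemannianMetric I ∞ (EuclideanSpace ℝ (Fin m)) (TangentSpace I : M → Type _)}
  {cov : ℝ → CovariantDerivative I (EuclideanSpace ℝ (Fin m)) (TangentSpace I : M → Type _)}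
  (hh : IsContMDiffFamilyOn ∞ h univ) (hR : ∀ r, (h r).IsRiemannian)

omit [T2Space M] [SecondCountableTopology M] [MeasurableSpace M] [BorelSpace M] [I.Boundaryless]
  [ChartedSpace H M] [IsManifold I ∞ M] in
/-- **Slices of a continuous function on `M × Y` vary uniformly continuously in the parameter**
(`M` compact; tube lemma): `sup_z |Φ(z, y) − Φ(z, y₀)| → 0` as `y → y₀`. [folklore] -/
theorem eventually_forall_abs_sub_lt_of_continuous_prod {Y : Type*} [TopologicalSpace Y]
    {Φ : M × Y → ℝ} (hΦ : Continuous Φ) (y₀ : Y) {ε : ℝ} (hε : 0 < ε) :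
    ∀ᶠ y in 𝓝 y₀, ∀ z, |Φ (z, y) - Φ (z, y₀)| < ε := by
  set n : Set (M × Y) := {p | |Φ p - Φ (p.1, y₀)| < ε}
  have hn : IsOpen n := isOpen_lt (by fun_prop) continuous_const
  have hp : (univ : Set M) ×ˢ ({y₀} : Set Y) ⊆ n := by
    rintro ⟨z, y⟩ ⟨-, hy⟩
    rw [mem_singleton_iff] at hy
    subst hy
    simpa [n] using hε
  obtain ⟨u, w, -, hw, hu, hy₀w, huw⟩ :=
    generalized_tube_lemma isCompact_univ isCompact_singleton hn hp
  filter_upwards [hw.mem_nhds (hy₀w (mem_singleton y₀))] with y hy z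
  exact huw ⟨hu (mem_univ z), hy⟩

include hh hR in
/-- **The heat propagation of a continuous datum is jointly continuous in space-time**:
for continuous `g`, `(x, t) ↦ (P_{r→t} g)(x)` is continuous on `M × [r, ∞)` (uniform limit of the
smooth space-time propagations `contMDiffOn_heatValue_spaceTime` of the smooth approximants of `g`,
by the maximum principle `abs_heatValue_sub_heatValueC_le`). [cite: Bamler2020Entropy, §2] -/
theorem continuousOn_heatValueC_spaceTime (r : ℝ) {g : M → ℝ} (hg : Continuous g) :
    ContinuousOn (fun p : M × ℝ ↦ heatValueC h r p.2 p.1 g) (univ ×ˢ Ici r) := by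
  have hunif : TendstoUniformlyOn (fun n (p : M × ℝ) ↦ heatValue h r p.2 p.1 (smoothApprox I g n))
      (fun p ↦ heatValueC h r p.2 p.1 g) atTop (univ ×ˢ Ici r) := by
    rw [Metric.tendstoUniformlyOn_iff]
    intro ε hε
    obtain ⟨N, hN⟩ := exists_nat_one_div_lt hε
    refine eventually_atTop.2 ⟨N, fun n hn p _ ↦ ?_⟩
    rw [Real.dist_eq, abs_sub_comm]
    have hb := abs_heatValue_sub_heatValueC_le hh hR (s := r) (t := p.2) p.1 hg
      (contMDiff_smoothApprox hg n) fun z ↦ (abs_smoothApprox_sub_lt (I := I) hg n z).le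
    have hn' : 1 / ((n : ℝ) + 1) ≤ 1 / ((N : ℝ) + 1) :=
      one_div_le_one_div_of_le (by positivity) (by exact_mod_cast Nat.add_le_add_right hn 1)
    linarith
  exact hunif.continuousOn (Frequently.of_forall fun n ↦
    (contMDiffOn_heatValue_spaceTime hh hR r (contMDiff_smoothApprox hg n)).continuousOn)

include hh hR in
/-- **`(x, t) ↦ ∫ g dν_{x,t;r}` is continuous on `M × (r, ∞)`** for continuous `g` (weak continuity
of the heat kernel measures in the base point AND the base time). [cite: Bamler2020Entropy, §2.3] -/
theorem continuousOn_integral_heatKernelMeasure_spaceTime (r : ℝ) {g : M → ℝ} (hg : Continuous g) :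
    ContinuousOn (fun p : M × ℝ ↦ ∫ z, g z ∂(heatKernelMeasure hh hR p.2 p.1 r))
      (univ ×ˢ Ioi r) := by
  refine ((continuousOn_heatValueC_spaceTime hh hR r hg).mono
    (prod_mono le_rfl Ioi_subset_Ici_self)).congr fun p hp ↦ ?_
  exact integral_heatKernelMeasure hh hR hp.2 p.1 hg

include hh hR in
/-- **Joint continuity with a parameter**: for `F` continuous on `M × M`,
`((x, t), y) ↦ ∫ F(z, y) dν_{x,t;r}(z)` is continuous on `(M × (r, ∞)) × M` (uniform continuity of
`F` in `y` on the compact `M`, and the previous statement). [cite: Bamler2020Entropy, §2.3] -/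
theorem continuousOn_integral_heatKernelMeasure_param (r : ℝ) {F : M × M → ℝ} (hF : Continuous F) :
    ContinuousOn (fun q : (M × ℝ) × M ↦ ∫ z, F (z, q.2) ∂(heatKernelMeasure hh hR q.1.2 q.1.1 r))
      ((univ ×ˢ Ioi r) ×ˢ univ) := by
  rintro ⟨⟨x₀, t₀⟩, y₀⟩ hq₀
  have ht₀ : r < t₀ := hq₀.1.2
  set S : Set ((M × ℝ) × M) := (univ ×ˢ Ioi r) ×ˢ univ with hS
  rw [ContinuousWithinAt, Metric.tendsto_nhds]
  intro ε hε
  -- integrability of the slices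
  have hFi : ∀ (y : M) (μ : Measure M) [IsFiniteMeasure μ], Integrable (fun z ↦ F (z, y)) μ :=
    fun y μ _ ↦ (hF.comp (continuous_id.prodMk continuous_const)).integrable_of_hasCompactSupport
      (HasCompactSupport.of_compactSpace _)
  -- (A) the parameter: `sup_z |F(z, y) − F(z, y₀)| < ε/2` near `y₀`
  have hA : ∀ᶠ q in 𝓝[S] ((x₀, t₀), y₀), |(∫ z, F (z, q.2) ∂(heatKernelMeasure hh hR q.1.2 q.1.1 r)) -
      ∫ z, F (z, y₀) ∂(heatKernelMeasure hh hR q.1.2 q.1.1 r)| ≤ ε / 2 := by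
    have hev := eventually_forall_abs_sub_lt_of_continuous_prod hF y₀ (half_pos hε)
    have hev' : ∀ᶠ q in 𝓝 (((x₀, t₀), y₀) : (M × ℝ) × M), ∀ z, |F (z, q.2) - F (z, y₀)| < ε / 2 :=
      (continuous_snd.tendsto (((x₀, t₀), y₀) : (M × ℝ) × M)).eventually hev
    refine eventually_nhdsWithin_of_eventually_nhds (hev'.mono fun q hq ↦ ?_)
    rw [← integral_sub (hFi q.2 _) (hFi y₀ _)]
    exact abs_integral_heatKernelMeasure_le hh hR _ _ _ fun z ↦ (hq z).le
  -- (B) the base point: continuity of `(x, t) ↦ ∫ F(z, y₀) dν_{x,t;r}`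
  have hB : ∀ᶠ q in 𝓝[S] ((x₀, t₀), y₀),
      dist (∫ z, F (z, y₀) ∂(heatKernelMeasure hh hR q.1.2 q.1.1 r))
        (∫ z, F (z, y₀) ∂(heatKernelMeasure hh hR t₀ x₀ r)) < ε / 2 := by
    have hG := continuousOn_integral_heatKernelMeasure_spaceTime hh hR r
      (hF.comp (continuous_id.prodMk continuous_const) : Continuous fun z ↦ F (z, y₀))
    have hG' : ContinuousOn (fun q : (M × ℝ) × M ↦ ∫ z, F (z, y₀) ∂(heatKernelMeasure hh hR q.1.2 q.1.1 r))
        S := hG.comp continuousOn_fst fun q hq ↦ hq.1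
    have := (hG' _ hq₀).tendsto
    rw [Metric.tendsto_nhds] at this
    exact this (ε / 2) (half_pos hε)
  filter_upwards [hA, hB] with q hqA hqB
  rw [Real.dist_eq] at hqB ⊢
  calc |(∫ z, F (z, q.2) ∂(heatKernelMeasure hh hR q.1.2 q.1.1 r)) -
        ∫ z, F (z, y₀) ∂(heatKernelMeasure hh hR t₀ x₀ r)|
      ≤ |(∫ z, F (z, q.2) ∂(heatKernelMeasure hh hR q.1.2 q.1.1 r)) -
          ∫ z, F (z, y₀) ∂(heatKernelMeasure hh hR q.1.2 q.1.1 r)| +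
        |(∫ z, F (z, y₀) ∂(heatKernelMeasure hh hR q.1.2 q.1.1 r)) -
          ∫ z, F (z, y₀) ∂(heatKernelMeasure hh hR t₀ x₀ r)| := abs_sub_le _ _ _
    _ < ε := by linarith

include hh hR in
/-- **The conjugate heat kernels of all base times at once** (Bamler 2020a, §2.3, `K(x,t;y,s)` for
all `s < t`): for a Ricci flow on `[a, T]`, `a < T`, on a closed connected manifold there is
`𝒦 : ℝ → M → M × ℝ → ℝ` such that for every base time `t ∈ (a, T]` the family `𝒦 t` has all the
properties of `IsRicciFlow.exists_conjugateHeatKernel_family_pos` on `M × (a, t)` (smooth in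
`(y, s)`, positive, density of `ν_{x,t;s}`, conjugate heat equation, Lipschitz in `x`, jointly
continuous). [cite: Bamler2020Entropy, §2.3] -/
theorem IsRicciFlow.exists_conjugateHeatKernel_timeFamily [PreconnectedSpace M] {a T : ℝ}
    (hflow : IsRicciFlow h cov (Icc a T)) :
    ∃ 𝒦 : ℝ → M → M × ℝ → ℝ, ∀ t ∈ Ioc a T,
      (∀ x, ContMDiffOn (I.prod 𝓘(ℝ, ℝ)) 𝓘(ℝ, ℝ) ∞ (𝒦 t x) (univ ×ˢ Ioo a t)) ∧
      (∀ x, ∀ p ∈ univ ×ˢ Ioo a t, 0 < 𝒦 t x p) ∧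
      (∀ x, ∀ s ∈ Ioo a t, heatKernelMeasure hh hR t x s =
        (h s).riemVolume.withDensity fun y ↦ ENNReal.ofReal (𝒦 t x (y, s))) ∧
      (∀ x, ∀ p ∈ univ ×ˢ Ioo a t, deriv (fun s ↦ 𝒦 t x (p.1, s)) p.2 =
        -(h p.2).laplaceBeltrami (fun y ↦ 𝒦 t x (y, p.2)) p.1 +
          (h p.2).scalarCurvatureWith (cov p.2) p.1 * 𝒦 t x p) ∧
      (∀ a' b', a < a' → a' < b' → b' < t → ∃ L : ℝ, ∀ (x x' : M), ∀ p ∈ univ ×ˢ Icc a' b',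
        ENNReal.ofReal |𝒦 t x p - 𝒦 t x' p| ≤ ENNReal.ofReal L * (h t).edist (hR t) x x') ∧
      ContinuousOn (fun q : M × (M × ℝ) ↦ 𝒦 t q.1 q.2) (univ ×ˢ (univ ×ˢ Ioo a t)) := by
  have key : ∀ t, t ∈ Ioc a T → ∃ K : M → M × ℝ → ℝ,
      (∀ x, ContMDiffOn (I.prod 𝓘(ℝ, ℝ)) 𝓘(ℝ, ℝ) ∞ (K x) (univ ×ˢ Ioo a t)) ∧
      (∀ x, ∀ p ∈ univ ×ˢ Ioo a t, 0 < K x p) ∧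
      (∀ x, ∀ s ∈ Ioo a t, heatKernelMeasure hh hR t x s =
        (h s).riemVolume.withDensity fun y ↦ ENNReal.ofReal (K x (y, s))) ∧
      (∀ x, ∀ p ∈ univ ×ˢ Ioo a t, deriv (fun s ↦ K x (p.1, s)) p.2 =
        -(h p.2).laplaceBeltrami (fun y ↦ K x (y, p.2)) p.1 +
          (h p.2).scalarCurvatureWith (cov p.2) p.1 * K x p) ∧
      (∀ a' b', a < a' → a' < b' → b' < t → ∃ L : ℝ, ∀ (x x' : M), ∀ p ∈ univ ×ˢ Icc a' b',
        ENNReal.ofReal |K x p - K x' p| ≤ ENNReal.ofReal L * (h t).edist (hR t) x x') ∧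
      ContinuousOn (fun q : M × (M × ℝ) ↦ K q.1 q.2) (univ ×ˢ (univ ×ˢ Ioo a t)) :=
    fun t ht ↦ (hflow.mono (Icc_subset_Icc le_rfl ht.2)).exists_conjugateHeatKernel_family_pos
      hh hR ht.1
  choose K hK using key
  refine ⟨fun t ↦ if ht : t ∈ Ioc a T then K t ht else fun _ _ ↦ 0, fun t ht ↦ ?_⟩
  simp only [dif_pos ht]
  exact hK t ht

include hh hR in
/-- **Continuity of `K(x,t;y,s)` in `(x, t, y)`** (Bamler 2020a, §2.3): let `𝒦 t x (y, s)`,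
`t ∈ (a, T]`, be nonnegative jointly continuous (in `(x, y, s)`) densities of the heat kernel
measures `ν_{x,t;s}`, `s ∈ (a, t)`, of a `C^∞` family of Riemannian metrics on a closed manifold
(as provided by `IsRicciFlow.exists_conjugateHeatKernel_timeFamily`). Then for `s ∈ (a, T)`,
`((x, t), y) ↦ 𝒦 t x (y, s)` is continuous on `(M × (s, T]) × M`: near a base time `t₀` one
writes `𝒦 t x (y, s) = ∫ 𝒦 r z (y, s) dν_{x,t;r}(z)` for a fixed `r ∈ (s, t₀)`
(`conjugateHeatKernel_family_reproduction`) and uses the joint continuity of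
`continuousOn_integral_heatKernelMeasure_param`. [cite: Bamler2020Entropy, §2.3] -/
theorem continuousOn_conjugateHeatKernel_timeFamily {a T : ℝ} {𝒦 : ℝ → M → M × ℝ → ℝ}
    (h𝒦0 : ∀ t ∈ Ioc a T, ∀ x, ∀ p ∈ univ ×ˢ Ioo a t, 0 ≤ 𝒦 t x p)
    (h𝒦ν : ∀ t ∈ Ioc a T, ∀ x, ∀ s ∈ Ioo a t, heatKernelMeasure hh hR t x s =
      (h s).riemVolume.withDensity fun y ↦ ENNReal.ofReal (𝒦 t x (y, s)))
    (h𝒦c : ∀ t ∈ Ioc a T, ContinuousOn (fun q : M × (M × ℝ) ↦ 𝒦 t q.1 q.2)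
      (univ ×ˢ (univ ×ˢ Ioo a t)))
    {s : ℝ} (hs : s ∈ Ioo a T) :
    ContinuousOn (fun q : (M × ℝ) × M ↦ 𝒦 q.1.2 q.1.1 (q.2, s)) ((univ ×ˢ Ioc s T) ×ˢ univ) := by
  rintro ⟨⟨x₀, t₀⟩, y₀⟩ hq₀
  have ht₀ : t₀ ∈ Ioc s T := hq₀.1.2
  set S : Set ((M × ℝ) × M) := (univ ×ˢ Ioc s T) ×ˢ univ with hS
  -- an intermediate time `r ∈ (s, t₀)` and the open set `{t > r}`
  set r : ℝ := (s + t₀) / 2 with hr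
  have hsr : s < r := by rw [hr]; linarith [ht₀.1]
  have hrt₀ : r < t₀ := by rw [hr]; linarith [ht₀.1]
  have hrT : r ∈ Ioc a T := ⟨hs.1.trans hsr, (hrt₀.trans_le ht₀.2).le⟩
  have hsr' : s ∈ Ioo a r := ⟨hs.1, hsr⟩
  set O : Set ((M × ℝ) × M) := (univ ×ˢ Ioi r) ×ˢ univ with hO
  have hOo : IsOpen O := (isOpen_univ.prod isOpen_Ioi).prod isOpen_univ
  have hq₀O : ((x₀, t₀), y₀) ∈ O := ⟨⟨mem_univ _, hrt₀⟩, mem_univ _⟩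
  have hOmem : O ∈ 𝓝[S] ((x₀, t₀), y₀) := mem_nhdsWithin_of_mem_nhds (hOo.mem_nhds hq₀O)
  -- the reproduced expression, continuous on `O`
  have hF : Continuous fun q : M × M ↦ 𝒦 r q.1 (q.2, s) :=
    (h𝒦c r hrT).comp_continuous (continuous_fst.prodMk (continuous_snd.prodMk continuous_const))
      fun q ↦ ⟨mem_univ _, mem_univ _, hsr'⟩
  have hG := continuousOn_integral_heatKernelMeasure_param hh hR r hF
  have hGq₀ : ContinuousWithinAt
      (fun q : (M × ℝ) × M ↦ ∫ z, 𝒦 r z (q.2, s) ∂(heatKernelMeasure hh hR q.1.2 q.1.1 r)) S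
      ((x₀, t₀), y₀) :=
    ((hG _ hq₀O).mono_of_mem_nhdsWithin (mem_nhdsWithin_of_mem_nhds (hOo.mem_nhds hq₀O))).mono_of_mem_nhdsWithin
      (by rw [nhdsWithin_restrict' S (hOo.mem_nhds hq₀O), inter_comm]; exact self_mem_nhdsWithin)
  -- the two agree on `S ∩ O`
  have heq : ∀ q ∈ S ∩ O, 𝒦 q.1.2 q.1.1 (q.2, s) =
      ∫ z, 𝒦 r z (q.2, s) ∂(heatKernelMeasure hh hR q.1.2 q.1.1 r) := by
    rintro ⟨⟨x, t⟩, y⟩ ⟨hqS, hqO⟩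
    have ht : t ∈ Ioc a T := ⟨hrT.1.trans hqO.1.2, hqS.1.2.2⟩
    exact conjugateHeatKernel_family_reproduction hh hR hqO.1.2 (h𝒦0 t ht) (h𝒦ν t ht) (h𝒦c t ht)
      (h𝒦0 r hrT) (h𝒦ν r hrT) (h𝒦c r hrT) x hsr' y
  refine hGq₀.congr_of_eventuallyEq ?_ (heq _ ⟨hq₀, hq₀O⟩)
  exact eventuallyEq_of_mem (inter_mem self_mem_nhdsWithin hOmem) heq

include hh hR in
/-- **Continuity of `(x, t) ↦ K(x,t;y,s)`** for fixed `(y, s)`, on `M × (s, T]` (slice of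
`continuousOn_conjugateHeatKernel_timeFamily`). [cite: Bamler2020Entropy, §2.3] -/
theorem continuousOn_conjugateHeatKernel_timeFamily_basePoint {a T : ℝ} {𝒦 : ℝ → M → M × ℝ → ℝ}
    (h𝒦0 : ∀ t ∈ Ioc a T, ∀ x, ∀ p ∈ univ ×ˢ Ioo a t, 0 ≤ 𝒦 t x p)
    (h𝒦ν : ∀ t ∈ Ioc a T, ∀ x, ∀ s ∈ Ioo a t, heatKernelMeasure hh hR t x s =
      (h s).riemVolume.withDensity fun y ↦ ENNReal.ofReal (𝒦 t x (y, s)))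
    (h𝒦c : ∀ t ∈ Ioc a T, ContinuousOn (fun q : M × (M × ℝ) ↦ 𝒦 t q.1 q.2)
      (univ ×ˢ (univ ×ˢ Ioo a t)))
    {s : ℝ} (hs : s ∈ Ioo a T) (y : M) :
    ContinuousOn (fun p : M × ℝ ↦ 𝒦 p.2 p.1 (y, s)) (univ ×ˢ Ioc s T) :=
  (continuousOn_conjugateHeatKernel_timeFamily hh hR h𝒦0 h𝒦ν h𝒦c hs).comp
    (continuousOn_id.prodMk continuousOn_const) fun _ hp ↦ ⟨hp, mem_univ _⟩

end BasePoint

end Literature.Geometry.Riemannian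

end
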